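import Literature.NumberTheory.GaloisRepresentations.LubinTateColemanRelativeLogDerivTwo
import Literature.NumberTheory.GaloisRepresentations.LubinTateColemanRelativeTildeTwo
import Literature.NumberTheory.GaloisRepresentations.LubinTateColemanRelativeKernelTwo
import Literature.NumberTheory.GaloisRepresentations.LubinTateColemanLogDerivSurjModTwo
import Literature.NumberTheory.GaloisRepresentations.LubinTateColemanTraceKernelTwo
import Mathlib.RingTheory.MvPowerSeries.Expand
import Mathlib.RingTheory.PowerSeries.Expand
import HarnessLib

/-!
# `q = 2`, relative situation: Coleman's `δ_E` is surjective modulo `π` onto the TWISTED `𝒮_E`-eigenseries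
# (de Shalit I §3.12 Lemma + Corollary over an unramified base `k' = E`, residue characteristic two)

De Shalit, *Iwasawa theory of elliptic curves with complex multiplication* (1987), Ch. I §3.12: over an unramified base
`k'` with Frobenius `φ`, "`δ` maps `{g : 𝒩g = g^φ}` ONTO `{h : 𝒮h = h^φ}`"; the proof computes `𝒮` modulo `𝔭'` and
uses Cartier's criterion for logarithmic derivatives in characteristic `p` (§3.11).  The tree has the absolute case
(`LubinTateColemanLogDerivSurjModTwo`: `𝒪_F`-coefficients, no twist).  THIS FILE proves the FIRST STEP of the
Corollary in the relative, twisted setting at `q = 2` (`f = πX + X²`, `π = 2u` with `u ∈ 𝒪_F^×`, e.g. `F = ℚ₂`; `E ⊇ F`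
finite, `ψ` a ring automorphism of `𝒪_E` with `ψ(π) = π` and `ψ(c) ≡ c² (mod π)` — the Frobenius of an unramified `E`):

* ★★★ `exists_relNormTwo_eq_map_sub_relLogDeriv_mem` — **if `𝒮_E h = π·h^ψ` then `h ≡ δ_E g (mod π)` for a
  PRINCIPAL unit `g ∈ 𝒪_E⟦X⟧ˣ` with `𝒩_E g = g^ψ`.**

The route AVOIDS de Shalit's Taylor computation of `𝒮` modulo `𝔭'²` over `𝒪_E`: the residual equation is read off
the EXACT structure theorems already in the tree — `h̃ = h − u·(h^ψ ∘ f) ∈ ker 𝒮_E = (1 + u⁻¹X)·𝒪_E⟦f⟧`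
(`relTraceTwo_twistedTilde_eq_zero`, `relTraceTwo_eq_zero_iff`) — which reduces modulo `π` to
**`h̄ + h̄² = (1 + X)·r̄(X²)`** in `(𝒪_E/π)⟦X⟧` (`ū = 1`, `(h^ψ ∘ f)‾ = h̄^{Fr}(X²) = h̄²`); and the reduced invariant
differential is **`ω̄_F = 1 + X`** (`invDiff_sub_one_add_mul_X_mem_coeffIdeal`, from the tree's `𝒪_F`-Taylor congruence
`(𝒮h)∘f ≡ 2h − πω_F h' (mod π²)` at `h = X` and `𝒮X = −π`).  Then Cartier's criterion (`PowerSeriesLogDerivCharP`), the twisted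
`𝒩_E`-invariant unit lift (`existsUnique_isUnit_relNormTwo_eq_map`) and a characteristic-`2` coefficient comparison
(`eq_zero_of_residual_eq`) finish as in the absolute file.  Everything PROVED (0 sorry); no unramifiedness is used beyond the
hypothesis `ψ(c) ≡ c²`.

## References

* E. de Shalit, *Iwasawa theory of elliptic curves with complex multiplication* (1987), Ch. I §3.11 Lemma, §3.12 Lemma and
  Corollary. [deShalit1987]
* R. Coleman, *Division values in local fields*, Invent. Math. 53 (1979). [Coleman1979]
-/

noncomputable section

open scoped PowerSeries.WithPiTopology

/-! ### A characteristic-`2` coefficient lemma -/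

namespace PowerSeries

variable {R : Type*} [CommRing R]

/-- `coeff 0 ((1 + X)·q) = coeff 0 q`. [folklore] -/
private theorem coeff_zero_one_add_X_mul (q : R⟦X⟧) : coeff 0 ((1 + X) * q) = coeff 0 q := by
  rw [add_mul, one_mul, map_add, coeff_zero_X_mul, add_zero]

/-- `coeff (d+1) ((1 + X)·q) = coeff (d+1) q + coeff d q`. [folklore] -/
private theorem coeff_succ_one_add_X_mul (q : R⟦X⟧) (d : ℕ) :
    coeff (d + 1) ((1 + X) * q) = coeff (d + 1) q + coeff d q := by
  rw [add_mul, one_mul, map_add, coeff_succ_X_mul]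

/-- In characteristic `2`: `t² = (t^{Fr})(X²)`, so `coeff (2m) (t²) = (coeff m t)²` and odd coefficients of `t²` vanish.
[folklore] -/
private theorem sq_eq_expand_map_frobenius [CharP R 2] (t : R⟦X⟧) :
    t ^ 2 = expand 2 two_ne_zero (t.map (frobenius R 2)) := by
  haveI : ExpChar R 2 := ExpChar.prime Nat.prime_two
  rw [← map_expand, ← MvPowerSeries.map_frobenius_expand 2 two_ne_zero]
  rfl

/-- ★ **The characteristic-`2` contradiction for the residual twisted eigen-equation** (de Shalit I §3.12, `p = 2`
reading over `𝒪_{k'}/p`): over a ring of characteristic `2`, if `s` has only odd exponents and `t = (1 + X)·s` satisfies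
`t + t² = (1 + X)·r(X²)`, then `s = 0` (at the first exponent `m = 2n₀+1` of `s` the relation `t_{2n₀+1} = t_{2n₀} + t_{n₀}²`
reads `s_m = 0`). [cite: deShalit1987, Ch. I §3.12 Lemma (proof)] -/
theorem eq_zero_of_residual_eq [CharP R 2] (s r : R⟦X⟧) (hs : ∀ n, coeff (2 * n) s = 0)
    (heq : (1 + X) * s + ((1 + X) * s) ^ 2 = (1 + X) * expand 2 two_ne_zero r) : s = 0 := by
  classical
  by_contra hne
  have hex : ∃ m, coeff m s ≠ 0 := by
    by_contra hall
    push Not at hall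
    exact hne (PowerSeries.ext fun k => by rw [hall k, map_zero])
  set m := Nat.find hex with hm_def
  have hm : coeff m s ≠ 0 := Nat.find_spec hex
  have hlt : ∀ d < m, coeff d s = 0 := fun d hd => by
    have := Nat.find_min hex hd
    simpa using this
  -- `m` is odd
  obtain ⟨n₀, hn₀⟩ : ∃ n₀, m = 2 * n₀ + 1 := by
    rcases Nat.even_or_odd m with ⟨k, hk⟩ | ⟨k, hk⟩
    · exact absurd (hs k) (by rw [two_mul, ← hk]; exact hm)
    · exact ⟨k, hk⟩
  set t := (1 + X) * s with ht
  -- `t_d = 0` for `d < m`, `t_m = s_m`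
  have htlt : ∀ d < m, coeff d t = 0 := by
    intro d hd
    rcases d with _ | d
    · rw [ht, coeff_zero_one_add_X_mul, hlt 0 hd]
    · rw [ht, coeff_succ_one_add_X_mul, hlt (d + 1) hd, hlt d (by omega), add_zero]
  have htm : coeff m t = coeff m s := by
    rw [hn₀, ht, coeff_succ_one_add_X_mul, hs n₀, add_zero]
  -- coefficient `2n₀` of `heq`: `t_{2n₀} + t_{n₀}² = r_{n₀}`; coefficient `2n₀+1`: `t_{2n₀+1} = r_{n₀}`
  have hsq := sq_eq_expand_map_frobenius t
  have h1 : coeff (2 * n₀) ((1 + X) * expand 2 two_ne_zero r) = coeff n₀ r := by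
    rcases Nat.eq_zero_or_pos n₀ with h0 | hpos
    · subst h0
      rw [mul_zero, coeff_zero_one_add_X_mul, coeff_zero_eq_constantCoeff_apply, constantCoeff_expand,
        ← coeff_zero_eq_constantCoeff_apply]
    · obtain ⟨k, hk⟩ : ∃ k, 2 * n₀ = k + 1 := ⟨2 * n₀ - 1, by omega⟩
      rw [hk, coeff_succ_one_add_X_mul, ← hk, coeff_expand_mul,
        coeff_expand_of_not_dvd 2 two_ne_zero r (m := k) (by omega), add_zero]
  have h2 : coeff (2 * n₀ + 1) ((1 + X) * expand 2 two_ne_zero r) = coeff n₀ r := by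
    rw [coeff_succ_one_add_X_mul, coeff_expand_mul, coeff_expand_of_not_dvd 2 two_ne_zero r (by omega), zero_add]
  have k1 := congrArg (coeff (2 * n₀)) heq
  rw [map_add, hsq, coeff_expand_mul, coeff_map, frobenius_def, h1] at k1
  have k2 := congrArg (coeff (2 * n₀ + 1)) heq
  rw [map_add, hsq, coeff_expand_of_not_dvd 2 two_ne_zero _ (by omega), add_zero, h2] at k2
  -- `t_{2n₀+1} = t_{2n₀} + t_{n₀}^2 = 0`, but `t_{2n₀+1} = s_m ≠ 0`
  rw [← k1, htlt (2 * n₀) (by omega), htlt n₀ (by omega), zero_pow two_ne_zero, add_zero, ← hn₀, htm] at k2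
  exact hm k2

/-- **`t = 0` from the residual equation and an even-supported `X(1+X)⁻¹t`**: if `(1 + X)W = 1`, `X·W·t = ρ` with
`ρ(0) = 0` and `ρ` without odd exponents, and `t + t² = (1 + X)·r(X²)`, then `t = 0` (`t = (1 + X)·(X⁻¹ρ)` and
`eq_zero_of_residual_eq`). [cite: deShalit1987, Ch. I §3.12 Lemma (proof)] -/
theorem eq_zero_of_residual_eq_of_X_mul [CharP R 2] {t ρ W r : R⟦X⟧} (hW : (1 + X) * W = 1)
    (hρ : X * W * t = ρ) (hρ0 : constantCoeff ρ = 0) (hρodd : ∀ m, coeff (2 * m + 1) ρ = 0)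
    (heq : t + t ^ 2 = (1 + X) * expand 2 two_ne_zero r) : t = 0 := by
  obtain ⟨s, hs⟩ : ∃ s : R⟦X⟧, s = PowerSeries.mk fun m => coeff (m + 1) ρ := ⟨_, rfl⟩
  have hXs : X * s = ρ := by
    ext m
    rcases m with _ | m
    · rw [coeff_zero_X_mul, coeff_zero_eq_constantCoeff_apply, hρ0]
    · rw [coeff_succ_X_mul, hs, coeff_mk]
  have hsodd : ∀ m, coeff (2 * m) s = 0 := fun m => by rw [hs, coeff_mk, hρodd]
  have ht : t = (1 + X) * s := by
    have e1 : X * ((1 + X) * s) = X * t := by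
      linear_combination (1 + X) * hXs - (1 + X) * hρ + X * t * hW
    ext m
    have hm := congrArg (coeff (m + 1)) e1
    rw [coeff_succ_X_mul, coeff_succ_X_mul] at hm
    exact hm.symm
  rw [ht] at heq ⊢
  rw [eq_zero_of_residual_eq s r hsodd heq, mul_zero]

end PowerSeries

namespace Literature.NumberTheory.GaloisRepresentations

section GenericCharTwo

/-- **The Cartier part of a series** (de Shalit I §3.12, proof of the Lemma): over a ring of characteristic `2`, every `k`
with `k(0) = 0` differs from some `xdlog ḡ` (`ḡ` a unit with `ḡ(0) = 1`, from Cartier's criterion §3.11 applied to the series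
`i` with `i_{odd} = k_{odd}`, `i_{2n} = i_n²`) by an even-supported series without constant term.
[cite: deShalit1987, Ch. I §3.11 Lemma, §3.12 Lemma (proof)] -/
theorem exists_unit_sub_xdlog_even {R : Type*} [CommRing R] [CharP R 2] (k : PowerSeries R)
    (hk0 : PowerSeries.constantCoeff k = 0) :
    ∃ g : (PowerSeries R)ˣ, PowerSeries.constantCoeff (g : PowerSeries R) = 1 ∧
      PowerSeries.constantCoeff (k - PowerSeries.xdlog g) = 0 ∧
      ∀ m, PowerSeries.coeff (2 * m + 1) (k - PowerSeries.xdlog g) = 0 := by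
  haveI : Fact (Nat.Prime 2) := ⟨Nat.prime_two⟩
  obtain ⟨i, hi⟩ : ∃ i : PowerSeries R, i = PowerSeries.mk (cartierCoeff fun m => PowerSeries.coeff m k) := ⟨_, rfl⟩
  have hi0 : PowerSeries.constantCoeff i = 0 := by
    rw [← PowerSeries.coeff_zero_eq_constantCoeff_apply, hi, PowerSeries.coeff_mk, cartierCoeff]
  have hiC : PowerSeries.IsCartier 2 i := by
    intro m
    rw [hi, PowerSeries.coeff_mk, PowerSeries.coeff_mk, cartierCoeff_two_mul]
  have hiodd : ∀ m, PowerSeries.coeff (2 * m + 1) i = PowerSeries.coeff (2 * m + 1) k := fun m => by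
    rw [hi, PowerSeries.coeff_mk, cartierCoeff_odd]
  refine ⟨PowerSeries.limitUnit (p := 2) (h := i), ?_, ?_, ?_⟩
  · rw [PowerSeries.limitUnit, IsUnit.unit_spec]
    exact PowerSeries.constantCoeff_limitSeries
  · rw [PowerSeries.xdlog_limitUnit hi0 hiC, map_sub, hk0, hi0, sub_zero]
  · intro m
    rw [PowerSeries.xdlog_limitUnit hi0 hiC, map_sub, hiodd, sub_self]

end GenericCharTwo

/-- `d⁄dX` commutes with coefficientwise maps (private copy of a tree one-liner). [folklore] -/
private theorem derivative_map₄ {R T : Type*} [CommRing R] [CommRing T] (φ : R →+* T) (G : PowerSeries R) :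
    PowerSeries.derivative T (G.map φ) = (PowerSeries.derivative R G).map φ := by
  ext n
  simp only [PowerSeries.coeff_derivative, PowerSeries.coeff_map, map_mul, map_add, map_natCast, map_one]

section LocalFieldResidualDiff

open GaloisRepresentations.IsNonarchimedeanLocalField LubinTate ValuativeRel

variable (F : Type*) [Field F] [ValuativeRel F] [TopologicalSpace F] [IsNonarchimedeanLocalField F]

attribute [local instance] ltNormUniformSpace ltNormIsUniformAddGroup rk1 nF nE fintypeResidueField

variable {F}
variable {π : 𝒪[F]} (hπ : (valuation F).IsUniformizer (π : F))

/-! ### The invariant differential modulo `π` at `q = 2`: `ω_F ≡ 1 + tX` (`2 = πt`) -/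

/-- ★ **`ω_F ≡ 1 + tX (mod π)`** for `f = πX + X²`, `2 = πt` (so `ω̄_F = 1 + X` over `ℚ₂`, `ω̄_F = 1` if `F/ℚ₂` is ramified):
the Taylor congruence `(𝒮h)∘f ≡ 2h − π·ω_F·h' (mod π²)` at `h = X` together with `𝒮X = −π`.
[cite: deShalit1987, Ch. I §3.12 Lemma (proof)] -/
theorem invDiff_sub_one_add_mul_X_mem_coeffIdeal (hq : residueFieldCard F = 2) {t : LTCoeff F}
    (ht : (2 : LTCoeff F) = LTCoeff.of F π * t) :
    invDiff (isLTRing_LTCoeff hπ) (isLTSeries_LTCoeff π) - (1 + PowerSeries.C t * PowerSeries.X) ∈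
      coeffIdeal (Ideal.span {LTCoeff.of F π}) := by
  have hs : PowerSeries.HasSubst (ltSer F π) :=
    PowerSeries.HasSubst.of_constantCoeff_zero' (isLTSeries_ltSer π).constantCoeff_eq_zero
  have h1 := subst_colemanTrace_sub_mem_coeffIdeal_sq hπ 0 hq PowerSeries.X
  have e1 : PowerSeries.subst (ltSer F π) (colemanTrace hπ 0 PowerSeries.X) = -PowerSeries.C (LTCoeff.of F π) := by
    rw [colemanTrace_X_two hπ 0 hq, ← PowerSeries.coe_substAlgHom hs, map_neg, PowerSeries.C_eq_algebraMap, AlgHom.commutes]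
  have e2 : (2 : PowerSeries (LTCoeff F)) = PowerSeries.C (LTCoeff.of F π) * PowerSeries.C t := by
    rw [← map_mul, ← ht, map_ofNat]
  have e : PowerSeries.subst (ltSer F π) (colemanTrace hπ 0 PowerSeries.X) -
      (2 * PowerSeries.X - PowerSeries.C (LTCoeff.of F π) *
        (invDiff (isLTRing_LTCoeff hπ) (isLTSeries_LTCoeff π) * PowerSeries.derivative (LTCoeff F) PowerSeries.X)) =
      PowerSeries.C (LTCoeff.of F π) *
        (invDiff (isLTRing_LTCoeff hπ) (isLTSeries_LTCoeff π) - (1 + PowerSeries.C t * PowerSeries.X)) := by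
    rw [e1, e2, PowerSeries.derivative_X]; ring
  rw [e] at h1
  exact mem_coeffIdeal_of_C_mul_mem_sq hπ h1

include hπ in
/-- A unit of `𝒪_F` is `≡ 1 (mod π)` when `|𝓀_F| = 2` (`𝓀_F^× = 1`). [cite: SerreLocalFields1979, Ch. I §8] -/
theorem sub_one_mem_span_of_isUnit (hq : residueFieldCard F = 2) {w : LTCoeff F} (hw : IsUnit w) :
    w - 1 ∈ Ideal.span {LTCoeff.of F π} := by
  classical
  rw [← residue_eq_zero_iff_mem hπ, map_sub, map_sub, map_one, map_one, sub_eq_zero]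
  have hu : IsUnit (IsLocalRing.residue 𝒪[F] ((LTCoeff.of F).symm w)) := (hw.map (LTCoeff.of F).symm).map _
  have hcard : Fintype.card 𝓀[F] = 2 := by rw [← Nat.card_eq_fintype_card]; exact hq
  have hcu : Fintype.card (𝓀[F])ˣ = 1 := by rw [Fintype.card_units, hcard]
  haveI : Subsingleton (𝓀[F])ˣ := Fintype.card_le_one_iff_subsingleton.mp hcu.le
  obtain ⟨v, hv⟩ := hu
  rw [← hv, Subsingleton.elim v 1, Units.val_one]

end LocalFieldResidualDiff

section RelativeResidual

open GaloisRepresentations.IsNonarchimedeanLocalField LubinTate ValuativeRel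

variable (F : Type*) [Field F] [ValuativeRel F] [TopologicalSpace F] [IsNonarchimedeanLocalField F]

attribute [local instance] ltNormUniformSpace ltNormIsUniformAddGroup rk1 nF nE fintypeResidueField

variable {F}

section Red

variable (E : IntermediateField F (AlgebraicClosure F)) [FiniteDimensional F E]

/-! ### Reduction modulo `π` of `𝒪_E⟦X⟧` -/

/-- **Reduction of coefficients `𝒪_E⟦X⟧ → (𝒪_E/π𝒪_E)⟦X⟧`.** [cite: deShalit1987, Ch. I §3.12] -/
def redE (π : 𝒪[F]) : PowerSeries (unitBall E) →+* PowerSeries (unitBall E ⧸ Ideal.span {algebraMap 𝒪[F] (unitBall E) π}) :=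
  PowerSeries.map (Ideal.Quotient.mk _)

/-- Coefficients of the reduction (unfolding). [cite: deShalit1987, Ch. I §3.12] -/
theorem coeff_redE (π : 𝒪[F]) (G : PowerSeries (unitBall E)) (k : ℕ) :
    PowerSeries.coeff k (redE E π G) = Ideal.Quotient.mk _ (PowerSeries.coeff k G) := by
  rw [redE, PowerSeries.coeff_map]

/-- `red (C c) = C c̄`. [cite: deShalit1987, Ch. I §3.12] -/
theorem redE_C (π : 𝒪[F]) (c : unitBall E) : redE E π (PowerSeries.C c) = PowerSeries.C (Ideal.Quotient.mk _ c) := by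
  rw [redE, PowerSeries.map_C]

/-- `red X = X`. [cite: deShalit1987, Ch. I §3.12] -/
theorem redE_X (π : 𝒪[F]) : redE E π PowerSeries.X = PowerSeries.X := by
  rw [redE, PowerSeries.map_X]

/-- The algebra maps `LTCoeff F → 𝒪_E` and `𝒪[F] → 𝒪_E` agree (unfolding). [folklore] -/
private theorem algebraMap_LTCoeff_of (a : 𝒪[F]) :
    algebraMap (LTCoeff F) (unitBall E) (LTCoeff.of F a) = algebraMap 𝒪[F] (unitBall E) a := rfl

/-- `red G = 0 ↔ G ≡ 0 (mod π)` coefficientwise. [cite: deShalit1987, Ch. I §3.12] -/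
theorem redE_eq_zero_iff (π : 𝒪[F]) (G : PowerSeries (unitBall E)) :
    redE E π G = 0 ↔ G ∈ coeffIdeal (Ideal.span {algebraMap 𝒪[F] (unitBall E) π}) := by
  rw [redE, mem_coeffIdeal_iff_map_mk_eq_zero]

/-- `red G = red G' ↔ G ≡ G' (mod π)`. [cite: deShalit1987, Ch. I §3.12] -/
theorem redE_eq_iff (π : 𝒪[F]) (G G' : PowerSeries (unitBall E)) :
    redE E π G = redE E π G' ↔ G - G' ∈ coeffIdeal (Ideal.span {algebraMap 𝒪[F] (unitBall E) π}) := by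
  rw [← redE_eq_zero_iff, map_sub, sub_eq_zero]

/-- `red` commutes with `d⁄dX`. [cite: deShalit1987, Ch. I §3.12] -/
theorem redE_derivative (π : 𝒪[F]) (G : PowerSeries (unitBall E)) :
    redE E π (PowerSeries.derivative (unitBall E) G) = PowerSeries.derivative _ (redE E π G) := by
  rw [redE, derivative_map₄]

end Red

variable {π : 𝒪[F]} (hπ : (valuation F).IsUniformizer (π : F))
variable (E : IntermediateField F (AlgebraicClosure F)) [FiniteDimensional F E]

include hπ in
/-- `π` is not a unit of `𝒪_E` (`‖π‖ < 1`). [cite: deShalit1987, Ch. I §1.1] -/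
theorem not_isUnit_algebraMap_pi : ¬ IsUnit (algebraMap 𝒪[F] (unitBall E) π) := fun hu => by
  have h1 := norm_algebraMap_pi_lt_one hπ E
  rw [Valuation.Integers.isUnit_iff_valuation_eq_one (Valuation.integer.integers (NormedField.valuation (K := E)))] at hu
  have h2 : ‖((algebraMap 𝒪[F] (unitBall E) π : unitBall E) : E)‖ = 1 := congrArg Subtype.val hu
  exact absurd h2 (ne_of_lt h1)

include hπ in
/-- `2 ∈ π𝒪_E` at `q = 2`. [cite: deShalit1987, Ch. I §3.12] -/
theorem two_mem_span_algebraMap_pi (hq : residueFieldCard F = 2) :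
    (2 : unitBall E) ∈ Ideal.span {algebraMap 𝒪[F] (unitBall E) π} := by
  obtain ⟨u, hu⟩ := exists_two_eq_pi_mul hπ hq
  have e : (2 : unitBall E) = algebraMap (LTCoeff F) (unitBall E) 2 := (map_ofNat _ 2).symm
  rw [e, hu, map_mul, algebraMap_LTCoeff_of]
  exact Ideal.mul_mem_right _ _ (Ideal.mem_span_singleton_self _)

include hπ in
/-- `𝒪_E/π𝒪_E` has characteristic `2` at `q = 2`. [cite: deShalit1987, Ch. I §3.12] -/
theorem charP_quotient_two (hq : residueFieldCard F = 2) :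
    CharP (unitBall E ⧸ Ideal.span {algebraMap 𝒪[F] (unitBall E) π}) 2 := by
  haveI : Nontrivial (unitBall E ⧸ Ideal.span {algebraMap 𝒪[F] (unitBall E) π}) :=
    ⟨⟨0, 1, Ideal.Quotient.zero_ne_one_iff.mpr (Ideal.span_singleton_ne_top (not_isUnit_algebraMap_pi hπ E))⟩⟩
  refine (CharP.charP_iff_prime_eq_zero Nat.prime_two).mpr ?_
  have h := (Ideal.Quotient.eq_zero_iff_mem).mpr (two_mem_span_algebraMap_pi hπ E hq)
  rwa [map_ofNat] at h

include hπ in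
/-- `(𝒪_E/π𝒪_E)⟦X⟧` has characteristic `2` at `q = 2`. [cite: deShalit1987, Ch. I §3.12] -/
theorem charP_powerSeries_quotient_two (hq : residueFieldCard F = 2) :
    CharP (PowerSeries (unitBall E ⧸ Ideal.span {algebraMap 𝒪[F] (unitBall E) π})) 2 :=
  haveI := charP_quotient_two hπ E hq
  charP_of_injective_algebraMap (R := unitBall E ⧸ Ideal.span {algebraMap 𝒪[F] (unitBall E) π})
    (A := PowerSeries (unitBall E ⧸ Ideal.span {algebraMap 𝒪[F] (unitBall E) π})) (fun a b hab => by
      have := congrArg PowerSeries.constantCoeff hab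
      simpa using this) 2

/-- **`red(G^ψ) = (red G)^{Fr}`** for `ψ` with `ψ(c) ≡ c² (mod π)` (the Frobenius of an unramified `E`).
[cite: deShalit1987, Ch. I §3.12] -/
theorem redE_map_of_sub_sq_mem [CharP (unitBall E ⧸ Ideal.span {algebraMap 𝒪[F] (unitBall E) π}) 2]
    {ψ : unitBall E →+* unitBall E}
    (hψ2 : ∀ c : unitBall E, ψ c - c ^ 2 ∈ Ideal.span {algebraMap 𝒪[F] (unitBall E) π}) (G : PowerSeries (unitBall E)) :
    redE E π (PowerSeries.map ψ G) = PowerSeries.map (frobenius _ 2) (redE E π G) := by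
  ext k
  rw [coeff_redE, PowerSeries.coeff_map, PowerSeries.coeff_map, coeff_redE, frobenius_def,
    ← map_pow (Ideal.Quotient.mk (Ideal.span {algebraMap 𝒪[F] (unitBall E) π})), Ideal.Quotient.eq]
  exact hψ2 _

set_option maxHeartbeats 800000 in
/-- **`red(G ∘ f) = (red G)(X²)`** (`f ≡ X² (mod π)`). [cite: deShalit1987, Ch. I §3.12] -/
theorem redE_subst_map_ltSer (hq : residueFieldCard F = 2) (G : PowerSeries (unitBall E)) :
    redE E π (PowerSeries.subst ((ltSer F π).map (algebraMap (LTCoeff F) (unitBall E))) G) =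
      PowerSeries.expand 2 two_ne_zero (redE E π G) := by
  have hs : PowerSeries.HasSubst ((ltSer F π).map (algebraMap (LTCoeff F) (unitBall E))) :=
    PowerSeries.HasSubst.of_constantCoeff_zero' ((isLTSeries_ltSer π).map _).constantCoeff_eq_zero
  have hf : redE E π ((ltSer F π).map (algebraMap (LTCoeff F) (unitBall E))) = PowerSeries.X ^ 2 := by
    rw [map_ltSer_eq E, hq, map_add (redE E π), map_mul (redE E π), map_pow (redE E π), redE_C, redE_X,
      Ideal.Quotient.eq_zero_iff_mem.mpr (Ideal.mem_span_singleton_self _), map_zero, zero_mul, zero_add]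
  have e : redE E π (PowerSeries.subst ((ltSer F π).map (algebraMap (LTCoeff F) (unitBall E))) G) =
      PowerSeries.subst (redE E π ((ltSer F π).map (algebraMap (LTCoeff F) (unitBall E)))) (redE E π G) :=
    PowerSeries.map_subst hs G
  rw [e, hf, PowerSeries.expand_apply]

/-- `red` kills `𝒪_F`-series that vanish modulo `π`: `red(ι H) = 0` for `H ∈ coeffIdeal_F(π)`. [cite: deShalit1987, Ch. I §3.12] -/
theorem redE_map_eq_zero_of_mem {H : PowerSeries (LTCoeff F)} (hH : H ∈ coeffIdeal (Ideal.span {LTCoeff.of F π})) :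
    redE E π (H.map (algebraMap (LTCoeff F) (unitBall E))) = 0 := by
  rw [redE_eq_zero_iff]
  intro k
  rw [PowerSeries.coeff_map]
  obtain ⟨c, hc⟩ := Ideal.mem_span_singleton'.mp (hH k)
  rw [← hc, map_mul (algebraMap (LTCoeff F) (unitBall E)), algebraMap_LTCoeff_of]
  exact Ideal.mul_mem_left _ _ (Ideal.mem_span_singleton_self _)

include hπ in
/-- `red(ι w) = 1` for a unit `w` of `𝒪_F` (`|𝓀_F| = 2`). [cite: deShalit1987, Ch. I §3.12] -/
theorem mk_algebraMap_eq_one_of_isUnit (hq : residueFieldCard F = 2) {w : LTCoeff F} (hw : IsUnit w) :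
    Ideal.Quotient.mk (Ideal.span {algebraMap 𝒪[F] (unitBall E) π}) (algebraMap (LTCoeff F) (unitBall E) w) = 1 := by
  rw [← map_one (Ideal.Quotient.mk (Ideal.span {algebraMap 𝒪[F] (unitBall E) π})), Ideal.Quotient.eq,
    ← map_one (algebraMap (LTCoeff F) (unitBall E)), ← map_sub (algebraMap (LTCoeff F) (unitBall E))]
  obtain ⟨c, hc⟩ := Ideal.mem_span_singleton'.mp (sub_one_mem_span_of_isUnit hπ hq hw)
  rw [← hc, map_mul (algebraMap (LTCoeff F) (unitBall E)), algebraMap_LTCoeff_of]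
  exact Ideal.mul_mem_left _ _ (Ideal.mem_span_singleton_self _)

set_option maxHeartbeats 800000 in
/-- ★ **`red(ι ω_F) = 1 + X`** at `q = 2` with `π = 2u`, `u ∈ 𝒪_F^×`. [cite: deShalit1987, Ch. I §3.12 Lemma (proof)] -/
theorem redE_map_invDiff (hq : residueFieldCard F = 2) (u : (LTCoeff F)ˣ) (hu : LTCoeff.of F π = residueFieldCard F * u) :
    redE E π ((invDiff (isLTRing_LTCoeff hπ) (isLTSeries_LTCoeff π)).map (algebraMap (LTCoeff F) (unitBall E))) =
      1 + PowerSeries.X := by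
  have ht := two_eq_of_mul_inv hq u hu
  have h0 := redE_map_eq_zero_of_mem E (invDiff_sub_one_add_mul_X_mem_coeffIdeal hπ hq ht)
  rw [map_sub (PowerSeries.map (algebraMap (LTCoeff F) (unitBall E))), map_sub (redE E π), sub_eq_zero] at h0
  have e1 : PowerSeries.map (algebraMap (LTCoeff F) (unitBall E)) (1 + PowerSeries.C (↑u⁻¹ : LTCoeff F) * PowerSeries.X) =
      1 + PowerSeries.C (algebraMap (LTCoeff F) (unitBall E) (↑u⁻¹ : LTCoeff F)) * PowerSeries.X := by
    rw [map_add (PowerSeries.map (algebraMap (LTCoeff F) (unitBall E))), map_one,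
      map_mul (PowerSeries.map (algebraMap (LTCoeff F) (unitBall E))), PowerSeries.map_C, PowerSeries.map_X]
  have e2 : redE E π (1 + PowerSeries.C (algebraMap (LTCoeff F) (unitBall E) (↑u⁻¹ : LTCoeff F)) * PowerSeries.X) =
      1 + PowerSeries.X := by
    rw [map_add (redE E π), map_one, map_mul (redE E π), redE_C, redE_X,
      mk_algebraMap_eq_one_of_isUnit hπ E hq (u⁻¹).isUnit, map_one, one_mul]
  rw [h0, e1, e2]

set_option maxHeartbeats 800000 in
/-- `red(dlog g) = dlog(red g)` (`red` is a ring map commuting with `d⁄dX`). [cite: deShalit1987, Ch. I §3.12] -/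
theorem redE_dlog (g : (PowerSeries (unitBall E))ˣ) :
    redE E π (PowerSeries.dlog g) = PowerSeries.dlog (Units.map (redE E π).toMonoidHom g) := by
  rw [PowerSeries.dlog_def, PowerSeries.dlog_def, map_mul (redE E π), redE_derivative, Units.coe_map, Units.coe_map_inv]
  rfl

set_option maxHeartbeats 800000 in
/-- ★ **`X · red(δ_E g) = (1 + X) · xdlog(red g)`** (`δ_E g = ι ω_F · g'/g`, `red(ι ω_F) = 1 + X`).
[cite: deShalit1987, Ch. I §3.12] -/
theorem X_mul_redE_relLogDeriv (hq : residueFieldCard F = 2) (u : (LTCoeff F)ˣ) (hu : LTCoeff.of F π = residueFieldCard F * u)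
    (g : (PowerSeries (unitBall E))ˣ) :
    PowerSeries.X * redE E π (relLogDeriv hπ E g) =
      (1 + PowerSeries.X) * PowerSeries.xdlog (Units.map (redE E π).toMonoidHom g) := by
  rw [relLogDeriv_def, map_mul (redE E π), redE_map_invDiff hπ E hq u hu, redE_dlog, PowerSeries.xdlog_def]
  ring

/-! ### The twisted eigen-equation modulo `π`: `h̄ + h̄² = (1 + X)·r̄(X²)` -/

set_option maxHeartbeats 800000 in
/-- ★ **The residual twisted eigen-equation at `q = 2`** (`π = 2u`, `u` a unit): if `𝒮_E h = π·h^ψ` with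
`ψ(c) ≡ c² (mod π)`, then in `(𝒪_E/π)⟦X⟧`: **`h̄ + h̄² = (1 + X)·r̄(X²)`** for some `r̄` — the reduction of
`h̃ = h − u·(h^ψ ∘ f) = (1 + u⁻¹X)·(r ∘ f)` (`ker 𝒮_E = (1 + u⁻¹X)·𝒪_E⟦f⟧`). [cite: deShalit1987, Ch. I §3.12 Lemma (proof), §3.13] -/
theorem exists_redE_add_sq_eq (hq : residueFieldCard F = 2) (u : (LTCoeff F)ˣ) (hu : LTCoeff.of F π = residueFieldCard F * u)
    {ψ : unitBall E →+* unitBall E} (hψ2 : ∀ c : unitBall E, ψ c - c ^ 2 ∈ Ideal.span {algebraMap 𝒪[F] (unitBall E) π})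
    {h : PowerSeries (unitBall E)}
    (hh : relTraceTwo hπ E hq h = PowerSeries.C (algebraMap 𝒪[F] (unitBall E) π) * PowerSeries.map ψ h) :
    ∃ r : PowerSeries (unitBall E ⧸ Ideal.span {algebraMap 𝒪[F] (unitBall E) π}),
      redE E π h + redE E π h ^ 2 = (1 + PowerSeries.X) * PowerSeries.expand 2 two_ne_zero r := by
  haveI := charP_quotient_two hπ E hq
  haveI := charP_powerSeries_quotient_two hπ E hq
  have ht := two_eq_of_mul_inv hq u hu
  obtain ⟨R, hR⟩ := (relTraceTwo_eq_zero_iff hπ E hq ht _).mp (relTraceTwo_twistedTilde_eq_zero hπ E hq hu ψ hh)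
  refine ⟨redE E π R, ?_⟩
  have h1 := congrArg (redE E π) hR
  simp only [map_sub, map_mul, map_add, map_one, redE_C, redE_X, redE_subst_map_ltSer E hq,
    mk_algebraMap_eq_one_of_isUnit hπ E hq u.isUnit, mk_algebraMap_eq_one_of_isUnit hπ E hq (u⁻¹).isUnit, map_one,
    one_mul, redE_map_of_sub_sq_mem E hψ2] at h1
  rw [← h1, PowerSeries.sq_eq_expand_map_frobenius, sub_eq_add_neg, CharTwo.neg_eq]

/-! ### Lifting units of `(𝒪_E/π)⟦X⟧` to twisted-`𝒩_E`-invariant units -/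

/-- Every series over `𝒪_E/π𝒪_E` lifts to `𝒪_E⟦X⟧` (coefficientwise). [folklore] -/
private theorem exists_redE_eq (Gbar : PowerSeries (unitBall E ⧸ Ideal.span {algebraMap 𝒪[F] (unitBall E) π})) :
    ∃ G : PowerSeries (unitBall E), redE E π G = Gbar := by
  refine ⟨PowerSeries.mk fun k => Function.surjInv (Ideal.Quotient.mk_surjective
    (I := Ideal.span {algebraMap 𝒪[F] (unitBall E) π})) (PowerSeries.coeff k Gbar), PowerSeries.ext fun k => ?_⟩
  rw [coeff_redE, PowerSeries.coeff_mk, Function.surjInv_eq (Ideal.Quotient.mk_surjective (I := _))]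

set_option maxHeartbeats 800000 in
include hπ in
/-- **A series whose reduction modulo `π` is a unit is a unit** (`𝒪_E` is `π`-adically complete: `c d ≡ 1 (mod π)` with `d` a
lift of `c̄⁻¹` makes `c d`, hence `c = G(0)`, a unit). [cite: deShalit1987, Ch. I §3.10 Lemma (proof)] -/
theorem isUnit_of_isUnit_redE {G : PowerSeries (unitBall E)} (hG : IsUnit (redE E π G)) : IsUnit G := by
  haveI := isAdicComplete_span_algebraMap_pi hπ E
  rw [PowerSeries.isUnit_iff_constantCoeff] at hG ⊢
  rw [← PowerSeries.coeff_zero_eq_constantCoeff_apply, coeff_redE, PowerSeries.coeff_zero_eq_constantCoeff_apply] at hG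
  obtain ⟨cbar, hcbar⟩ := hG
  obtain ⟨d, hd⟩ := Ideal.Quotient.mk_surjective (I := Ideal.span {algebraMap 𝒪[F] (unitBall E) π})
    ((cbar⁻¹ : (unitBall E ⧸ Ideal.span {algebraMap 𝒪[F] (unitBall E) π})ˣ) : unitBall E ⧸ _)
  have hcd : PowerSeries.constantCoeff G * d - 1 ∈ Ideal.span {algebraMap 𝒪[F] (unitBall E) π} := by
    rw [← Ideal.Quotient.eq, map_mul (Ideal.Quotient.mk (Ideal.span {algebraMap 𝒪[F] (unitBall E) π})), ← hcbar, hd,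
      Units.mul_inv, map_one]
  have hCu : IsUnit (PowerSeries.C (PowerSeries.constantCoeff G * d)) := by
    refine isUnit_of_sub_mem_coeffIdeal_span (p := algebraMap 𝒪[F] (unitBall E) π) isUnit_one ?_
    intro k
    rw [map_sub (PowerSeries.coeff k), PowerSeries.coeff_C, PowerSeries.coeff_one]
    split_ifs with hk
    · exact hcd
    · rw [sub_zero]; exact zero_mem _
  rw [PowerSeries.isUnit_iff_constantCoeff, PowerSeries.constantCoeff_C] at hCu
  exact isUnit_of_mul_isUnit_left hCu

set_option maxHeartbeats 800000 in
/-- ★ Every unit `ḡ` of `(𝒪_E/π)⟦X⟧` is the reduction of a unit `g ∈ 𝒪_E⟦X⟧ˣ` with `𝒩_E g = g^ψ` (lift, then de Shalit's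
twisted I §3.10 over `𝒪_E`). [cite: deShalit1987, Ch. I §3.10 Lemma] -/
theorem exists_relNormTwo_eq_map_redE_eq (hq : residueFieldCard F = 2) (ψ : unitBall E ≃+* unitBall E)
    (hψ : ψ (algebraMap 𝒪[F] (unitBall E) π) = algebraMap 𝒪[F] (unitBall E) π)
    (hψ2 : ∀ c : unitBall E, ψ c - c ^ 2 ∈ Ideal.span {algebraMap 𝒪[F] (unitBall E) π})
    (gbar : (PowerSeries (unitBall E ⧸ Ideal.span {algebraMap 𝒪[F] (unitBall E) π}))ˣ) :
    ∃ g : (PowerSeries (unitBall E))ˣ, relNormTwo hπ E hq (g : PowerSeries (unitBall E)) = PowerSeries.map (ψ : unitBall E →+* unitBall E) g ∧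
      redE E π (g : PowerSeries (unitBall E)) = gbar := by
  obtain ⟨G₀, hred⟩ := exists_redE_eq E (gbar : PowerSeries (unitBall E ⧸ Ideal.span {algebraMap 𝒪[F] (unitBall E) π}))
  have hunit : IsUnit G₀ := isUnit_of_isUnit_redE hπ E (by rw [hred]; exact gbar.isUnit)
  obtain ⟨G, ⟨hGu, hN, hG⟩, -⟩ := existsUnique_isUnit_relNormTwo_eq_map hπ E hq ψ hψ hψ2 hunit.unit
  refine ⟨hGu.unit, ?_, ?_⟩
  · rw [IsUnit.unit_spec]; exact hN
  · rw [IsUnit.unit_spec, ← hred]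
    rw [IsUnit.unit_spec] at hG
    exact (redE_eq_iff E π _ _).mpr hG

/-! ### The main step -/

set_option maxHeartbeats 800000 in
/-- ★★★ **Coleman's `δ_E` is surjective modulo `π` onto the twisted `𝒮_E`-eigenseries, at `q = 2`** (de Shalit I §3.12
Lemma + first step of the Corollary, relative situation: `f = πX + X²`, `π = 2u` with `u ∈ 𝒪_F^×` — e.g. `F = ℚ₂` — over any
finite `E ⊇ F`, `ψ` a ring automorphism of `𝒪_E` over `𝒪_F` with `ψ(c) ≡ c² (mod π)`): if `𝒮_E h = π·h^ψ` then
**`h ≡ δ_E g (mod π)`** for some PRINCIPAL unit `g ∈ 𝒪_E⟦X⟧ˣ` (`g(0) ≡ 1`) with **`𝒩_E g = g^ψ`**.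
Proof: `k = X(1+X)⁻¹h̄ = i + ρ` with `i` Cartier (`= xdlog ḡ₁` by Cartier's criterion, `ḡ₁` lifted to `g₁` with
`𝒩_E g₁ = g₁^ψ`) and `ρ` even-supported; `h₂ = h − δ_E g₁` again satisfies the twisted eigen-equation, `h̄₂ = (1+X)·s` with `s`
odd-supported, and `h̄₂ + h̄₂² = (1+X)r̄(X²)` forces `s = 0`. [cite: deShalit1987, Ch. I §3.12 Corollary] -/
theorem exists_relNormTwo_eq_map_sub_relLogDeriv_mem (hq : residueFieldCard F = 2) (u : (LTCoeff F)ˣ)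
    (hu : LTCoeff.of F π = residueFieldCard F * u) (ψ : unitBall E ≃+* unitBall E)
    (hψF : ∀ a : LTCoeff F, ψ (algebraMap (LTCoeff F) (unitBall E) a) = algebraMap (LTCoeff F) (unitBall E) a)
    (hψ2 : ∀ c : unitBall E, ψ c - c ^ 2 ∈ Ideal.span {algebraMap 𝒪[F] (unitBall E) π})
    (h : PowerSeries (unitBall E))
    (hh : relTraceTwo hπ E hq h = PowerSeries.C (algebraMap 𝒪[F] (unitBall E) π) * PowerSeries.map (ψ : unitBall E →+* unitBall E) h) :
    ∃ g : (PowerSeries (unitBall E))ˣ,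
      relNormTwo hπ E hq (g : PowerSeries (unitBall E)) = PowerSeries.map (ψ : unitBall E →+* unitBall E) g ∧
      PowerSeries.constantCoeff (g : PowerSeries (unitBall E)) - 1 ∈ Ideal.span {algebraMap 𝒪[F] (unitBall E) π} ∧
      h - relLogDeriv hπ E g ∈ coeffIdeal (Ideal.span {algebraMap 𝒪[F] (unitBall E) π}) := by
  classical
  haveI := charP_quotient_two hπ E hq
  haveI : Fact (Nat.Prime 2) := ⟨Nat.prime_two⟩
  have hψa : ∀ a : LTCoeff F, (ψ : unitBall E →+* unitBall E) (algebraMap (LTCoeff F) (unitBall E) a) =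
      algebraMap (LTCoeff F) (unitBall E) a := hψF
  have hψ : ψ (algebraMap 𝒪[F] (unitBall E) π) = algebraMap 𝒪[F] (unitBall E) π := hψF (LTCoeff.of F π)
  -- the unit `W = 1 + X` of the residual series ring and its inverse
  have hWu : IsUnit (1 + PowerSeries.X : PowerSeries (unitBall E ⧸ Ideal.span {algebraMap 𝒪[F] (unitBall E) π})) :=
    PowerSeries.isUnit_iff_constantCoeff.mpr (by rw [map_add, map_one, PowerSeries.constantCoeff_X, add_zero]; exact isUnit_one)
  obtain ⟨Winv, hWinv⟩ : ∃ W : PowerSeries (unitBall E ⧸ Ideal.span {algebraMap 𝒪[F] (unitBall E) π}),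
      W = ((hWu.unit⁻¹ : (PowerSeries (unitBall E ⧸ Ideal.span {algebraMap 𝒪[F] (unitBall E) π}))ˣ) : PowerSeries _) :=
    ⟨_, rfl⟩
  have hWWinv : (1 + PowerSeries.X) * Winv = 1 := by rw [hWinv]; exact hWu.mul_val_inv
  -- `k = X (1+X)⁻¹ h̄` and its Cartier part `xdlog ḡ`
  obtain ⟨k, hk⟩ : ∃ k : PowerSeries (unitBall E ⧸ Ideal.span {algebraMap 𝒪[F] (unitBall E) π}),
      k = PowerSeries.X * Winv * redE E π h := ⟨_, rfl⟩
  have hk0 : PowerSeries.constantCoeff k = 0 := by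
    rw [hk, mul_assoc, ← PowerSeries.coeff_zero_eq_constantCoeff_apply, PowerSeries.coeff_zero_X_mul]
  obtain ⟨gbar, hgbar1, hρ0, hρodd⟩ := exists_unit_sub_xdlog_even k hk0
  -- lift `ḡ` to `g₁` with `𝒩_E g₁ = g₁^ψ`
  obtain ⟨g₁, hN₁, hred₁⟩ := exists_relNormTwo_eq_map_redE_eq hπ E hq ψ hψ hψ2 gbar
  have hg₁0 : PowerSeries.constantCoeff (g₁ : PowerSeries (unitBall E)) - 1 ∈ Ideal.span {algebraMap 𝒪[F] (unitBall E) π} := by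
    rw [← Ideal.Quotient.eq, ← PowerSeries.coeff_zero_eq_constantCoeff_apply, ← coeff_redE, hred₁,
      PowerSeries.coeff_zero_eq_constantCoeff_apply, hgbar1, map_one]
  have hgbar' : Units.map (redE E π).toMonoidHom g₁ = gbar := Units.ext (by
    rw [Units.coe_map, RingHom.toMonoidHom_eq_coe, MonoidHom.coe_coe, hred₁])
  -- `h₂ = h - δ_E g₁` is again a twisted eigenseries, and `X (1+X)⁻¹ h̄₂ = k - xdlog ḡ`
  obtain ⟨h₂, hh₂⟩ : ∃ h₂ : PowerSeries (unitBall E), h₂ = h - relLogDeriv hπ E g₁ := ⟨_, rfl⟩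
  have hh₂S : relTraceTwo hπ E hq h₂ =
      PowerSeries.C (algebraMap 𝒪[F] (unitBall E) π) * PowerSeries.map (ψ : unitBall E →+* unitBall E) h₂ := by
    rw [hh₂, relTraceTwo_sub hπ E hq, hh, relTraceTwo_relLogDeriv_of_relNormTwo_eq_map hπ E hq hψa g₁ hN₁,
      map_sub (PowerSeries.map (ψ : unitBall E →+* unitBall E)), mul_sub]
  have hXδ : PowerSeries.X * Winv * redE E π (relLogDeriv hπ E g₁) = PowerSeries.xdlog gbar := by
    rw [mul_right_comm, X_mul_redE_relLogDeriv hπ E hq u hu, mul_right_comm, hWWinv, one_mul, hgbar']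
  have hXh₂ : PowerSeries.X * Winv * redE E π h₂ = k - PowerSeries.xdlog gbar := by
    rw [hh₂, map_sub (redE E π), mul_sub, hXδ, ← hk]
  -- the residual equation for `h₂` forces `h̄₂ = 0`
  obtain ⟨r, hr⟩ := exists_redE_add_sq_eq hπ E hq u hu hψ2 hh₂S
  have h0 : redE E π h₂ = 0 := PowerSeries.eq_zero_of_residual_eq_of_X_mul hWWinv hXh₂ hρ0 hρodd hr
  refine ⟨g₁, hN₁, hg₁0, ?_⟩
  rw [← redE_eq_zero_iff, ← hh₂, h0]

end RelativeResidual

end Literature.NumberTheory.GaloisRepresentations
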